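import Mathlib
import Summits.Ventures.DiscreteObjects.Mahler.MahlerMeasureAlgebraicInteger

/-!
# The Mahler measure of every integer polynomial is an algebraic integer (venture `DiscreteObjects`, target L)

Cell `pub-namedobj`, seat `pub-namedobj-mahler` (gen 10). Framing: lottery ticket; floor = certified
bounds/negative ranges.

[McKee–Smyth, *Around the Unit Circle*, Prop. 1.9] in full generality (gen 9 did the monic case,
`isIntegral_intMahlerMeasure_of_monic`): for every `P ∈ ℤ[X]`, `M(P)` is an algebraic integer.

Kernel route (the book's `p`-adic proof, phrased with Gauss norms).  Write
`P = a ∏ (X - αᵢ)` over a splitting field `K` (a number field).  For a finite place `v` of `K` with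
absolute value `| |ᵥ`, the Gauss norm is multiplicative (Mathlib `Polynomial.gaussNorm_mul`), so
`|a|ᵥ ∏ max(1, |αᵢ|ᵥ) = ‖P‖ᵥ ≤ 1` because `P` has integer coefficients; hence
`|a ∏_{i ∈ T} αᵢ|ᵥ ≤ 1` for EVERY sub-multiset `T` of the roots (`abv_mul_prod_le_gaussNorm`), and an
element of `K` which is `≤ 1` at all finite places is an algebraic integer
(`IsDedekindDomain.HeightOneSpectrum.mem_integers_of_valuation_le_one`).  Embedding `K ↪ ℂ`:
`lc(P) · ∏_{α ∈ T} α` is an algebraic integer for every sub-multiset `T` of the complex roots of `P`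
(`isIntegral_leadingCoeff_mul_prod_roots`) — in particular for the roots outside the unit circle,
whose product with `lc(P)` is real of absolute value `M(P)`.

* `abv_mul_prod_le_gaussNorm` — `|a · ∏ T|ᵥ ≤ ‖a ∏_{S}(X - α)‖ᵥ` for `T ≤ S` (nonarchimedean `v`);
* `isIntegral_of_adicAbv_le_one` — integrality criterion in a number field;
* `isIntegral_leadingCoeff_mul_prod_of_splits` — number-field form;
* `isIntegral_leadingCoeff_mul_prod_roots` — `lc(P) · ∏ T` is an algebraic integer, `T ≤` complex roots;
* `intMahlerMeasure_eq_norm_leadingCoeff_mul_prod_roots` — `M(P) = ‖lc(P) · ∏_{‖α‖>1} α‖`;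
* `isIntegral_intMahlerMeasure` — **Prop. 1.9: `M(P)` is an algebraic integer for every `P ∈ ℤ[X]`.**
-/

namespace Summit.Ventures.DiscreteObjects.Mahler

open Polynomial IsDedekindDomain
open scoped ComplexConjugate

/-! ### Gauss-norm domination over a field with a nonarchimedean absolute value -/

section GaussNorm

variable {K : Type*} [Field K]

/-- For an absolute value `w`: `w α ≤ ‖X - α‖_w` and `1 ≤ ‖X - α‖_w` (Gauss norm at radius `1`). -/
theorem le_gaussNorm_X_sub_C (w : AbsoluteValue K ℝ) (α : K) :
    w α ≤ (X - C α).gaussNorm w 1 ∧ (1 : ℝ) ≤ (X - C α).gaussNorm w 1 := by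
  constructor
  · have h := le_gaussNorm w (X - C α) zero_le_one 0
    simp only [coeff_sub, coeff_X_zero, coeff_C_zero, zero_sub, pow_zero, mul_one,
      AbsoluteValue.map_neg] at h
    exact h
  · have h := le_gaussNorm w (X - C α) zero_le_one 1
    simp only [coeff_sub, coeff_X_one, coeff_C, if_neg one_ne_zero, sub_zero, pow_one, mul_one,
      AbsoluteValue.map_one] at h
    exact h

/-- The Gauss norm (radius `1`, nonarchimedean absolute value) of a product over a multiset. -/
theorem gaussNorm_multiset_prod (w : AbsoluteValue K ℝ) (hna : IsNonarchimedean w)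
    (S : Multiset K[X]) : S.prod.gaussNorm w 1 = (S.map fun f => f.gaussNorm w 1).prod := by
  induction S using Multiset.induction_on with
  | empty => rw [Multiset.prod_zero, Multiset.map_zero, Multiset.prod_zero, ← C_1, gaussNorm_C, map_one]
  | cons f S ih => rw [Multiset.prod_cons, Multiset.map_cons, Multiset.prod_cons,
      gaussNorm_mul hna one_pos, ih]

/-- A polynomial all of whose coefficients have absolute value `≤ 1` has Gauss norm `≤ 1`. -/
theorem gaussNorm_le_one_of_coeff (w : AbsoluteValue K ℝ) (f : K[X]) (h : ∀ i, w (f.coeff i) ≤ 1) :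
    f.gaussNorm w 1 ≤ 1 := by
  obtain ⟨i, hi⟩ := exists_eq_gaussNorm w 1 f
  rw [hi, one_pow, mul_one]
  exact h i

/-- **Gauss-norm domination.** For a nonarchimedean absolute value `w`, `a ∈ K` and multisets
`T ≤ S` of elements of `K`: `w (a · ∏ T) ≤ ‖a · ∏_{α ∈ S} (X - α)‖_w`
(`= w(a) ∏_{S} max(1, w α)` by multiplicativity of the Gauss norm). -/
theorem abv_mul_prod_le_gaussNorm (w : AbsoluteValue K ℝ) (hna : IsNonarchimedean w) (a : K)
    {S T : Multiset K} (hTS : T ≤ S) :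
    w (a * T.prod) ≤ (C a * (S.map fun α => X - C α).prod).gaussNorm w 1 := by
  obtain ⟨U, rfl⟩ := Multiset.le_iff_exists_add.mp hTS
  clear hTS
  have hg : ∀ α : K, w α ≤ (X - C α).gaussNorm w 1 ∧ (1 : ℝ) ≤ (X - C α).gaussNorm w 1 :=
    le_gaussNorm_X_sub_C w
  rw [gaussNorm_mul hna one_pos, gaussNorm_multiset_prod w hna, Multiset.map_map, Function.comp_def,
    Multiset.map_add, Multiset.prod_add, AbsoluteValue.map_mul, map_multiset_prod, gaussNorm_C]
  set g : K → ℝ := fun α => (X - C α).gaussNorm w 1 with hgdef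
  have h0 : 0 ≤ (T.map w).prod := Multiset.prod_nonneg (fun x hx => by
    obtain ⟨α, _, rfl⟩ := Multiset.mem_map.mp hx
    exact w.nonneg α)
  have h1 : (T.map w).prod ≤ (T.map g).prod :=
    Multiset.prod_map_le_prod_map₀ _ _ (fun α _ => w.nonneg α) (fun α _ => (hg α).1)
  have h2 : (1 : ℝ) ≤ (U.map g).prod := by
    induction U using Multiset.induction_on with
    | empty => simp
    | cons α U ih =>
      rw [Multiset.map_cons, Multiset.prod_cons]
      have hα := (hg α).2
      nlinarith
  have hT0 : 0 ≤ (T.map g).prod := le_trans h0 h1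
  calc w a * (T.map (fun α => w α)).prod = w a * (T.map w).prod := rfl
    _ ≤ w a * (T.map g).prod := mul_le_mul_of_nonneg_left h1 (w.nonneg a)
    _ ≤ w a * ((T.map g).prod * (U.map g).prod) := by
        apply mul_le_mul_of_nonneg_left _ (w.nonneg a)
        nlinarith

end GaussNorm

/-! ### Integrality in a number field -/

/-- An element of a number field with `v`-adic absolute value `≤ 1` at every finite place `v` is an
algebraic integer. -/
theorem isIntegral_of_adicAbv_le_one {K : Type*} [Field K] [NumberField K] (x : K)
    (h : ∀ v : HeightOneSpectrum (NumberField.RingOfIntegers K),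
      v.adicAbv (one_lt_two : (1 : NNReal) < 2) x ≤ 1) : IsIntegral ℤ x := by
  have hx : x ∈ (algebraMap (NumberField.RingOfIntegers K) K).range := by
    apply HeightOneSpectrum.mem_integers_of_valuation_le_one
    intro v
    have := h v
    rw [HeightOneSpectrum.adicAbv] at this
    simp only [AbsoluteValue.coe_mk, MulHom.coe_mk, HeightOneSpectrum.adicAbvDef] at this
    exact (WithZeroMulInt.toNNReal_le_one_iff one_lt_two).mp (by exact_mod_cast this)
  obtain ⟨y, rfl⟩ := hx
  exact NumberField.RingOfIntegers.isIntegral_coe y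

/-- **Number-field form.** If `P ∈ ℤ[X]` splits in the number field `K` and `T` is a sub-multiset of
its roots there, then `lc(P) · ∏ T` is an algebraic integer. -/
theorem isIntegral_leadingCoeff_mul_prod_of_splits {K : Type*} [Field K] [NumberField K] (P : ℤ[X])
    (hsplit : (P.map (algebraMap ℤ K)).Splits) {T : Multiset K}
    (hT : T ≤ (P.map (algebraMap ℤ K)).roots) :
    IsIntegral ℤ (algebraMap ℤ K P.leadingCoeff * T.prod) := by
  apply isIntegral_of_adicAbv_le_one
  intro v
  set w : AbsoluteValue K ℝ := v.adicAbv (one_lt_two : (1 : NNReal) < 2) with hw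
  have hna : IsNonarchimedean w := HeightOneSpectrum.isNonarchimedean_adicAbv v _
  have hf := hsplit.eq_prod_roots
  have hlc : (P.map (algebraMap ℤ K)).leadingCoeff = algebraMap ℤ K P.leadingCoeff :=
    leadingCoeff_map_of_injective (algebraMap ℤ K).injective_int P
  calc w (algebraMap ℤ K P.leadingCoeff * T.prod)
      ≤ (C (algebraMap ℤ K P.leadingCoeff) *
          ((P.map (algebraMap ℤ K)).roots.map fun α => X - C α).prod).gaussNorm w 1 :=
        abv_mul_prod_le_gaussNorm w hna _ hT
    _ = (P.map (algebraMap ℤ K)).gaussNorm w 1 := by rw [← hlc, ← hf]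
    _ ≤ 1 := by
        refine gaussNorm_le_one_of_coeff w _ fun i => ?_
        rw [coeff_map]
        have : algebraMap ℤ K (P.coeff i) =
            algebraMap (NumberField.RingOfIntegers K) K ((P.coeff i : ℤ) : NumberField.RingOfIntegers K) := by
          simp
        rw [this, hw]
        exact HeightOneSpectrum.adicAbv_coe_le_one v _ _

/-! ### Transfer to `ℂ` -/

/-- A sub-multiset of an image multiset is an image of a sub-multiset. -/
theorem exists_le_map_eq_of_le_map {α β : Type*} [DecidableEq β] (f : α → β) :
    ∀ (S : Multiset α) (T : Multiset β), T ≤ S.map f → ∃ T' : Multiset α, T' ≤ S ∧ T'.map f = T := by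
  intro S
  induction S using Multiset.induction_on with
  | empty =>
    intro T hT
    rw [Multiset.map_zero, Multiset.le_zero] at hT
    exact ⟨0, le_rfl, by rw [hT, Multiset.map_zero]⟩
  | cons a S ih =>
    intro T hT
    rw [Multiset.map_cons] at hT
    by_cases ha : f a ∈ T
    · have hT' : T.erase (f a) ≤ S.map f := by
        rw [← Multiset.cons_erase ha, Multiset.cons_le_cons_iff] at hT
        exact hT
      obtain ⟨T', hT'S, hT'eq⟩ := ih _ hT'
      refine ⟨a ::ₘ T', Multiset.cons_le_cons a hT'S, ?_⟩
      rw [Multiset.map_cons, hT'eq, Multiset.cons_erase ha]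
    · rw [Multiset.le_cons_of_notMem ha] at hT
      obtain ⟨T', hT'S, hT'eq⟩ := ih _ hT
      exact ⟨T', hT'S.trans (Multiset.le_cons_self S a), hT'eq⟩

/-- **`lc(P) · ∏_{α ∈ T} α` is an algebraic integer** for every `P ∈ ℤ[X]` and every sub-multiset `T`
of the multiset of complex roots of `P` ([McKee–Smyth, proof of Prop. 1.9]: "`|a₀|_p` times the
product of any number of the `|α_j|_p` is at most `1`"). -/
theorem isIntegral_leadingCoeff_mul_prod_roots (P : ℤ[X]) {T : Multiset ℂ}
    (hT : T ≤ (P.map (Int.castRingHom ℂ)).roots) :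
    IsIntegral ℤ ((P.leadingCoeff : ℂ) * T.prod) := by
  classical
  -- the splitting field of `P` over `ℚ`, a number field, with an embedding into `ℂ`
  let PQ : ℚ[X] := P.map (Int.castRingHom ℚ)
  let K := PQ.SplittingField
  haveI : CharZero K := charZero_of_injective_algebraMap (algebraMap ℚ K).injective
  haveI : NumberField K := NumberField.mk
  let φ : K →ₐ[ℚ] ℂ := IsAlgClosed.lift
  have hmapK : P.map (algebraMap ℤ K) = PQ.map (algebraMap ℚ K) := by
    show P.map (algebraMap ℤ K) = (P.map (Int.castRingHom ℚ)).map (algebraMap ℚ K)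
    rw [Polynomial.map_map]
    congr 1
  have hsplitK : (P.map (algebraMap ℤ K)).Splits := by
    rw [hmapK]
    exact SplittingField.splits PQ
  have hPC : P.map (Int.castRingHom ℂ) = (P.map (algebraMap ℤ K)).map φ.toRingHom := by
    rw [Polynomial.map_map]
    congr 1
    exact RingHom.ext_int _ _
  have hroots : (P.map (Int.castRingHom ℂ)).roots = ((P.map (algebraMap ℤ K)).roots).map φ := by
    rw [hPC, ← roots_map_of_injective_of_card_eq_natDegree φ.toRingHom.injective
      (splits_iff_card_roots.mp hsplitK)]
    rfl
  rw [hroots] at hT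
  obtain ⟨T', hT'le, rfl⟩ := exists_le_map_eq_of_le_map φ _ _ hT
  have hint := isIntegral_leadingCoeff_mul_prod_of_splits P hsplitK hT'le
  have himg : (P.leadingCoeff : ℂ) * (T'.map φ).prod = φ (algebraMap ℤ K P.leadingCoeff * T'.prod) := by
    rw [map_mul, map_multiset_prod]
    congr 1
    simp
  rw [himg]
  exact map_isIntegral_int φ.toRingHom hint

/-! ### Prop. 1.9 -/

/-- `M(P) = ‖lc(P) · ∏_{‖α‖>1} α‖` (complex roots with multiplicity) for every `P ∈ ℤ[X]`. -/
theorem intMahlerMeasure_eq_norm_leadingCoeff_mul_prod_roots (P : ℤ[X]) :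
    intMahlerMeasure P = ‖(P.leadingCoeff : ℂ) *
      (((P.map (Int.castRingHom ℂ)).roots).filter fun a => ¬ ‖a‖ ≤ 1).prod‖ := by
  unfold intMahlerMeasure
  rw [mahlerMeasure_eq_leadingCoeff_mul_prod_roots, prod_map_max_one_norm, norm_mul,
    leadingCoeff_map_of_injective (Int.castRingHom ℂ).injective_int, eq_intCast]

/-- **[McKee–Smyth, Prop. 1.9]: the Mahler measure of every `P ∈ ℤ[X]` is an algebraic integer.** -/
theorem isIntegral_intMahlerMeasure (P : ℤ[X]) : IsIntegral ℤ (intMahlerMeasure P) := by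
  classical
  set S₂ := ((P.map (Int.castRingHom ℂ)).roots).filter fun a => ¬ ‖a‖ ≤ 1 with hS₂
  set β : ℂ := (P.leadingCoeff : ℂ) * S₂.prod with hβ
  have hβint : IsIntegral ℤ β := isIntegral_leadingCoeff_mul_prod_roots P (Multiset.filter_le _ _)
  -- `β` is real
  have hβconj : conj β = β := by
    rw [hβ, map_mul, conj_prod_roots_outside P, map_intCast]
  have hβreal : ((β.re : ℝ) : ℂ) = β := Complex.conj_eq_iff_re.mp hβconj
  have hre : IsIntegral ℤ β.re := by
    rw [← hβreal] at hβint
    exact (isIntegral_algebraMap_iff (A := ℝ) (B := ℂ) (algebraMap ℝ ℂ).injective).mp hβint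
  have hM : intMahlerMeasure P = |β.re| := by
    rw [intMahlerMeasure_eq_norm_leadingCoeff_mul_prod_roots, ← hS₂, ← hβ]
    conv_lhs => rw [← hβreal]
    rw [Complex.norm_real, Real.norm_eq_abs]
  rw [hM]
  rcases abs_choice β.re with h | h
  · rw [h]; exact hre
  · rw [h]; exact hre.neg

end Summit.Ventures.DiscreteObjects.Mahler
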